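import Mathlib
import HarnessLib
import Summits.HubbardSuperconductivity.HubbardSuperconductivity.Theorems.KLProgrammeKLRegimeVolumeLimitLastScalePlainRowsDoor
import Summits.HubbardSuperconductivity.HubbardSuperconductivity.Theorems.KLProgrammeKLRegimeVolumeLimitTorusPeriodisationSplit

/-!
# Route `KLProgramme` — crux K3, VL child `KLRegimeVolumeLimitV17F2` (stmt-HubbardSuperconductivity-20440): THE FAR ROWS OF THE END DOORS ARE
# PAID BY THE ONE-VOLUME WEIGHTED PROFILE — the augmented chain owes only the NEAR pinned defect
# (cell gate-hubbard-kl, seat hubbard-kl-k3c5-p3 g11, technique «OS-positivity-free direct assembly»)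

The pinned END doors of 20440 (`framedNestedFlowTextV17F2_of_plainRowsPinnedDefect` (b), `…_of_commonFramePlainRowsPinned` (d), and every earlier
pinned door) carry a FAR-ROWS term `Σ_{t₁} Σ_{y far} ‖W_{L″}(o_f,(t₁,o⃗_f+y))‖` — the rows of the FINE volume's last-scale two-leg kernel at offsets
`y ∈ 𝕋_{L″}` that are not centred lifts of coarse offsets (`proj_{L″}(cRep (y mod L)) ≠ y`).  Such offsets are far: `(L−1)/2 + 1 ≤ ‖y‖_𝕋`
(`le_tnorm_of_ne_clift`, k3c4-p1 `…TorusPeriodisationSplit`).  The producer token #24 «SRC2» (`SourceProfilesAt`, v9 stub `stub_vl_srcProfiles`)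
bounds, at every scale and in particular at `n⋆ = n_β + 1`, the source-pair rows of each volume in the TREE WEIGHT `klScaleWt_{n⋆} = 1 + Λ_{n⋆}·diam ≥
1 + Λ_{n⋆}·‖y‖_𝕋` with an `L`-free budget.  Hence the far rows are `≤ 2B/(1 + Λ_{n⋆}((L−1)/2+1)) → 0` for free, and the two-volume chain owes ONLY the
NEAR defect:

* §1 `twoEps_sum_far_le_of_weightedRows` — generic: `2ε·Σ_{t₁}Σ_{y far}‖W(o,(t₁,o⃗+y))‖ ≤ 2B/(1 + Λ((L−1)/2+1))` whenever
  `ε·Σ_{t₁}Σ_y (1 + Λ‖y‖_𝕋)·‖W(o,(t₁,o⃗+y))‖ ≤ B` (`ε, Λ ≥ 0`; ∘ `sum_far_norm_le_of_weighted`); `twoEps_sum_le_of_weightedRows` (weight ≥ 1);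
  `tendsto_farRate` (`2B/(1 + Λ((L−1)/2+1)) → 0` for `Λ > 0`).
* §2 **`framedNestedFlowTextV17F2_of_plainNearDefect_weightedRows`** (OWN flow frames): the registered text of `stub_vl_nestedFramed` from
  «`∃ L₀ δ→0 B`: for `L ≥ L₀`, `L″ = b·L`, eventually in `M`, ∃ pins with a common time: `2ε·NEAR ≤ δ L` and
  `ε·Σ_{t₁,y}(1 + Λ_{n⋆}‖y‖_𝕋)‖W_{L″}(o_f,(t₁,o⃗_f+y))‖ ≤ B`» where `NEAR = Σ_{t₁,ȳ}‖W_L(o_c,(t₁,o⃗_c+ȳ)) − W_{L″}(o_f,(t₁,o⃗_f+ȳ↑))‖`,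
  `W_V = sectorisedKernel β (trivialMultiplier) (klEffectiveAction V M β U μ (klFlowFrameU V …) klE0 n⋆) 2 ((0,0,+),(0,0,−))`, `Λ_{n⋆} = klScale klE0 n⋆`;
  **`framedNestedFlowTextV17F2_of_commonFramePlainNearDefect_weightedRows`** (both volumes at `K_L`): NEAR at the common frame + the weighted rows
  of BOTH volumes at `K_L` (the coarse one pays door (d)'s `B`).
By-`--workitem` closers: `…VolumeLimitV17F2FarRowsClosers`.  Proofs only; no definition; nothing asserts superconductivity.
References: BGM 2006 §2.4 (2.38), §2.9 (4.3)–(4.6).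
-/

noncomputable section

/-! ## §1 Far rows from a weighted one-volume row profile -/

namespace Summit.HubbardSuperconductivity.HubbardSuperconductivity.Theorems.TwoVolumeDefect

set_option linter.dupNamespace false -- summit = problem name (single-conjunct summit), D-0017

open Finset Filter Topology Complex Literature.MathematicalPhysics.QuantumLattice Literature.Probability.LatticeModels
open Summit.HubbardSuperconductivity.HubbardSuperconductivity.Theorems.TwoPointAssembly (sum_far_norm_le_of_weighted)

section Far

variable {Lc Lf b M : ℕ} [NeZero Lc] [NeZero Lf]

/-- **FAR ROWS ≤ WEIGHTED PROFILE / FAR WEIGHT**: if `ε·Σ_{t₁}Σ_y (1 + Λ‖y‖_𝕋)·‖W(o,(t₁,o⃗+y))‖ ≤ B` on the fine torus `L_f = b·L_c` (`ε, Λ ≥ 0`), then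
`2ε·Σ_{t₁}Σ_{y far}‖W(o,(t₁,o⃗+y))‖ ≤ 2B/(1 + Λ((L_c−1)/2+1))` («far» = not a centred lift of a coarse offset). [cite: BenfattoGiulianiMastropietro2006, §2.4 (2.38)] -/
theorem twoEps_sum_far_le_of_weightedRows (hL : Lf = b * Lc) (W : (Fin 2 → SpaceTimeIdx Lf M) → ℂ) (o : SpaceTimeIdx Lf M)
    {ε Λ B : ℝ} (hε : 0 ≤ ε) (hΛ : 0 ≤ Λ)
    (hB : ε * ∑ t₁ : ImagTimeIdx M, ∑ y : TorusSite 2 Lf, (1 + Λ * (Torus.tnorm y : ℝ)) * ‖W ![o, (t₁, o.2 + y)]‖ ≤ B) :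
    2 * ε * ∑ t₁ : ImagTimeIdx M,
        ∑ y ∈ univ.filter (fun y : TorusSite 2 Lf => Torus.proj Lf (Torus.cRep (fun i => (((y i).val : ℕ) : ZMod Lc))) ≠ y),
          ‖W ![o, (t₁, o.2 + y)]‖ ≤ 2 * B / (1 + Λ * ((((Lc - 1) / 2 + 1 : ℕ)) : ℝ)) := by
  classical
  set w : ℕ → ℝ := fun k => 1 + Λ * k with hw_def
  have hw : Monotone w := fun a c hac => by
    simp only [hw_def]
    have : (a : ℝ) ≤ c := by exact_mod_cast hac
    nlinarith
  have hw0 : ∀ k, 0 ≤ w k := fun k => by simp only [hw_def]; positivity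
  have hwR : 0 < w ((Lc - 1) / 2 + 1) := by simp only [hw_def]; positivity
  set g : TorusSite 2 Lf → ℂ := fun y => ((∑ t₁ : ImagTimeIdx M, ‖W ![o, (t₁, o.2 + y)]‖ : ℝ) : ℂ) with hg_def
  have hg : ∀ y, ‖g y‖ = ∑ t₁ : ImagTimeIdx M, ‖W ![o, (t₁, o.2 + y)]‖ := fun y => by
    rw [hg_def, Complex.norm_real, Real.norm_of_nonneg (sum_nonneg fun _ _ => norm_nonneg _)]
  set N : ℝ := ∑ y : TorusSite 2 Lf, w (Torus.tnorm y) * ‖g y‖ with hN_def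
  have hfar := sum_far_norm_le_of_weighted (d := 2) hL g hw hw0 hwR (le_refl N)
  have hεN : ε * N ≤ B := by
    have hN' : N = ∑ t₁ : ImagTimeIdx M, ∑ y : TorusSite 2 Lf, (1 + Λ * (Torus.tnorm y : ℝ)) * ‖W ![o, (t₁, o.2 + y)]‖ := by
      rw [hN_def, sum_comm]
      refine sum_congr rfl fun y _ => ?_
      rw [hg y, mul_sum]
    rw [hN']
    exact hB
  have hswap : (∑ t₁ : ImagTimeIdx M,
      ∑ y ∈ univ.filter (fun y : TorusSite 2 Lf => Torus.proj Lf (Torus.cRep (fun i => (((y i).val : ℕ) : ZMod Lc))) ≠ y),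
        ‖W ![o, (t₁, o.2 + y)]‖) =
      ∑ y ∈ univ.filter (fun y : TorusSite 2 Lf => Torus.proj Lf (Torus.cRep (fun i => (((y i).val : ℕ) : ZMod Lc))) ≠ y), ‖g y‖ := by
    rw [sum_comm]
    exact sum_congr rfl fun y _ => (hg y).symm
  rw [hswap]
  calc 2 * ε * ∑ y ∈ univ.filter (fun y : TorusSite 2 Lf => Torus.proj Lf (Torus.cRep (fun i => (((y i).val : ℕ) : ZMod Lc))) ≠ y), ‖g y‖
      ≤ 2 * ε * (N / w ((Lc - 1) / 2 + 1)) := mul_le_mul_of_nonneg_left hfar (by positivity)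
    _ = 2 * (ε * N) / w ((Lc - 1) / 2 + 1) := by ring
    _ ≤ 2 * B / w ((Lc - 1) / 2 + 1) := by gcongr

omit [NeZero Lc] in
/-- **Plain rows ≤ weighted rows** (weight `≥ 1`): `2ε·Σ_{t₁,y}‖W(o,(t₁,o⃗+y))‖ ≤ 2B`. [folklore] -/
theorem twoEps_sum_le_of_weightedRows (W : (Fin 2 → SpaceTimeIdx Lf M) → ℂ) (o : SpaceTimeIdx Lf M) {ε Λ B : ℝ} (hε : 0 ≤ ε) (hΛ : 0 ≤ Λ)
    (hB : ε * ∑ t₁ : ImagTimeIdx M, ∑ y : TorusSite 2 Lf, (1 + Λ * (Torus.tnorm y : ℝ)) * ‖W ![o, (t₁, o.2 + y)]‖ ≤ B) :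
    2 * ε * ∑ t₁ : ImagTimeIdx M, ∑ y : TorusSite 2 Lf, ‖W ![o, (t₁, o.2 + y)]‖ ≤ 2 * B := by
  have h : ∑ t₁ : ImagTimeIdx M, ∑ y : TorusSite 2 Lf, ‖W ![o, (t₁, o.2 + y)]‖ ≤
      ∑ t₁ : ImagTimeIdx M, ∑ y : TorusSite 2 Lf, (1 + Λ * (Torus.tnorm y : ℝ)) * ‖W ![o, (t₁, o.2 + y)]‖ := by
    refine sum_le_sum fun t₁ _ => sum_le_sum fun y _ => ?_
    have h1 : (1 : ℝ) ≤ 1 + Λ * (Torus.tnorm y : ℝ) := by have := mul_nonneg hΛ (Nat.cast_nonneg (Torus.tnorm y)); linarith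
    simpa using mul_le_mul_of_nonneg_right h1 (norm_nonneg (W ![o, (t₁, o.2 + y)]))
  calc 2 * ε * ∑ t₁ : ImagTimeIdx M, ∑ y : TorusSite 2 Lf, ‖W ![o, (t₁, o.2 + y)]‖
      ≤ 2 * ε * ∑ t₁ : ImagTimeIdx M, ∑ y : TorusSite 2 Lf, (1 + Λ * (Torus.tnorm y : ℝ)) * ‖W ![o, (t₁, o.2 + y)]‖ :=
        mul_le_mul_of_nonneg_left h (by positivity)
    _ = 2 * (ε * ∑ t₁ : ImagTimeIdx M, ∑ y : TorusSite 2 Lf, (1 + Λ * (Torus.tnorm y : ℝ)) * ‖W ![o, (t₁, o.2 + y)]‖) := by ring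
    _ ≤ 2 * B := by linarith

end Far

/-- **The far-rows rate vanishes**: `2B/(1 + Λ((L−1)/2+1)) → 0` as `L → ∞` (`Λ > 0`). [folklore] -/
theorem tendsto_farRate {Λ : ℝ} (hΛ : 0 < Λ) (B : ℝ) :
    Tendsto (fun L : ℕ => 2 * B / (1 + Λ * ((((L - 1) / 2 + 1 : ℕ)) : ℝ))) atTop (𝓝 0) := by
  refine Tendsto.div_atTop tendsto_const_nhds ?_
  have hφ : Tendsto (fun L : ℕ => (L - 1) / 2 + 1) atTop atTop :=
    tendsto_atTop_atTop.2 fun n => ⟨2 * n + 1, fun L hL => by omega⟩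
  have h1 : Tendsto (fun L : ℕ => Λ * ((((L - 1) / 2 + 1 : ℕ)) : ℝ)) atTop atTop :=
    (tendsto_natCast_atTop_atTop.comp hφ).const_mul_atTop hΛ
  exact tendsto_atTop_add_const_left _ _ h1

end Summit.HubbardSuperconductivity.HubbardSuperconductivity.Theorems.TwoVolumeDefect

/-! ## §2 The doors: NEAR defect + weighted one-volume rows -/

namespace Summit.HubbardSuperconductivity.HubbardSuperconductivity.Theorems.TwoPointAssembly

set_option linter.dupNamespace false -- summit = problem name (single-conjunct summit), D-0017

open Finset Filter Topology Complex Literature.MathematicalPhysics.QuantumLattice Literature.Probability.LatticeModels GrassmannAlgebra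
open Summit.HubbardSuperconductivity.HubbardSuperconductivity.Theorems.KLRegimeSplit
open Summit.HubbardSuperconductivity.HubbardSuperconductivity.Theorems.KLProgrammeLegKernels
open Summit.HubbardSuperconductivity.HubbardSuperconductivity.Theorems.TwoVolumeDefect

/-- **DOOR (f) — OWN FRAMES: NEAR PINNED DEFECT + WEIGHTED FINE-VOLUME ROWS.**  The registered text of `stub_vl_nestedFramed` from: `∃ L₀ δ→0 B`, for
`L ≥ L₀`, `L″ = b·L`, eventually in `M`, pins `o_c, o_f` with a common time such that `2ε·Σ_{t₁,ȳ}‖W_L(o_c,(t₁,o⃗_c+ȳ)) − W_{L″}(o_f,(t₁,o⃗_f+ȳ↑))‖ ≤ δ L`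
(NEAR, same centred offsets) and `ε·Σ_{t₁,y}(1 + Λ_{n⋆}‖y‖_𝕋)·‖W_{L″}(o_f,(t₁,o⃗_f+y))‖ ≤ B` (the scale-`n⋆` weighted source-pair profile of the fine
volume — token #24 at `n⋆`).  The far rows of door (b) are `≤ 2B/(1 + Λ_{n⋆}((L−1)/2+1)) → 0`. [cite: BenfattoGiulianiMastropietro2006, §2.9 (4.3)-(4.6)] -/
theorem framedNestedFlowTextV17F2_of_plainNearDefect_weightedRows
    (hD : ∀ (G : GeoConsts) (P : SplitConsts) (Q : EngConsts) (R : RenConsts), G.WF → P.WF → Q.WF → R.WF →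
      ∃ c₅ : ℝ, 0 < c₅ ∧ ∀ c : ℝ, 0 < c → c ≤ c₅ → ∃ U₀ : ℝ, 0 < U₀ ∧
        ∀ μ ∈ klWindowC, ∀ U : ℝ, 0 < U → U ≤ U₀ → ∀ β : ℝ, klBetaMin ≤ β → β ≤ Real.exp (c / U ^ 2) →
          ∀ K : TrigPolyC4v, klPredsV17F2.frameOK R U (nScales β) μ K →
            ∀ (Lstar : ℕ) (Mstar : ℕ → ℕ), TowerP klPredsV17F2 G P Q R β U μ K Lstar Mstar →
              ∃ L₀ : ℕ, ∃ δ : ℕ → ℝ, ∃ B : ℝ, Tendsto δ atTop (𝓝 0) ∧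
                ∀ (L : ℕ) [NeZero L], L₀ ≤ L → ∀ (L'' : ℕ) [NeZero L''] (b : ℕ), L'' = b * L → ∃ M₀ : ℕ, ∀ (M : ℕ) [NeZero M], M₀ ≤ M →
                  ∃ (oc : SpaceTimeIdx L M) (of : SpaceTimeIdx L'' M), of.1 = oc.1 ∧
                    2 * imagTimeWeight β M *
                      (∑ t₁ : ImagTimeIdx M, ∑ ybar : TorusSite 2 L,
                          ‖sectorisedKernel L M β (trivialMultiplier L M)
                                (klEffectiveAction L M β U μ (klFlowFrameU L M β U μ (nScales β + 1)) klE0 (nScales β + 1)) 2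
                                (![((0, 0), 0), ((0, 0), 1)] : Fin 2 → SectorLeg 1) ![oc, (t₁, oc.2 + ybar)] -
                            sectorisedKernel L'' M β (trivialMultiplier L'' M)
                                (klEffectiveAction L'' M β U μ (klFlowFrameU L'' M β U μ (nScales β + 1)) klE0 (nScales β + 1)) 2
                                (![((0, 0), 0), ((0, 0), 1)] : Fin 2 → SectorLeg 1) ![of, (t₁, of.2 + Torus.proj L'' (Torus.cRep ybar))]‖) ≤ δ L ∧
                    imagTimeWeight β M *
                      ∑ t₁ : ImagTimeIdx M, ∑ y : TorusSite 2 L'',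
                        (1 + klScale klE0 (nScales β + 1) * (Torus.tnorm y : ℝ)) *
                          ‖sectorisedKernel L'' M β (trivialMultiplier L'' M)
                              (klEffectiveAction L'' M β U μ (klFlowFrameU L'' M β U μ (nScales β + 1)) klE0 (nScales β + 1)) 2
                              (![((0, 0), 0), ((0, 0), 1)] : Fin 2 → SectorLeg 1) ![of, (t₁, of.2 + y)]‖ ≤ B) :
    ∀ (G : GeoConsts) (P : SplitConsts) (Q : EngConsts) (R : RenConsts), G.WF → P.WF → Q.WF → R.WF →
      ∃ c₅ : ℝ, 0 < c₅ ∧ ∀ c : ℝ, 0 < c → c ≤ c₅ → ∃ U₀ : ℝ, 0 < U₀ ∧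
        ∀ μ ∈ klWindowC, ∀ U : ℝ, 0 < U → U ≤ U₀ → ∀ β : ℝ, klBetaMin ≤ β → β ≤ Real.exp (c / U ^ 2) →
          ∀ K : TrigPolyC4v, klPredsV17F2.frameOK R U (nScales β) μ K →
            ∀ (Lstar : ℕ) (Mstar : ℕ → ℕ), TowerP klPredsV17F2 G P Q R β U μ K Lstar Mstar →
              ∀ n : ℤ, ∃ L₀ : ℕ, ∃ ρ : ℕ → ℝ, Tendsto ρ atTop (𝓝 0) ∧
                ∀ (L : ℕ) [NeZero L], L₀ ≤ L → ∀ (L'' : ℕ) [NeZero L''], L ∣ L'' → ∃ M₀ : ℕ, ∀ (M : ℕ) [NeZero M], M₀ ≤ M →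
                  ∀ (ω : MatsubaraIdx M), matsubaraInt M ω = n → ∀ (k : TorusSite 2 L) (k'' : TorusSite 2 L''),
                    latticeMomentum L'' k'' = latticeMomentum L k →
                      ‖klSelfEnergy L M β U μ (klFlowFrameU L M β U μ (nScales β + 1)) klE0 (nScales β + 1) (ω, k) 0 -
                          klSelfEnergy L'' M β U μ (klFlowFrameU L'' M β U μ (nScales β + 1)) klE0 (nScales β + 1) (ω, k'') 0‖ ≤ ρ L := by
  refine framedNestedFlowTextV17F2_of_plainRowsPinnedDefect fun G P Q R hG hP hQ hR => ?_
  obtain ⟨c₅, hc₅, hc⟩ := hD G P Q R hG hP hQ hR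
  refine ⟨c₅, hc₅, fun c hc0 hcc => ?_⟩
  obtain ⟨U₀, hU₀, hU⟩ := hc c hc0 hcc
  refine ⟨U₀, hU₀, fun μ hμ U hU0 hUU β hβmin hβmax K hK Lstar Mstar hT => ?_⟩
  have hβ : 0 < β := pos_of_klBetaMin_le hβmin
  have hΛ : 0 < klScale klE0 (nScales β + 1) := klth_klScale_pos _
  obtain ⟨L₀, δ, B, hδ, hDn⟩ := hU μ hμ U hU0 hUU β hβmin hβmax K hK Lstar Mstar hT
  refine ⟨L₀, fun L => δ L + 2 * B / (1 + klScale klE0 (nScales β + 1) * ((((L - 1) / 2 + 1 : ℕ)) : ℝ)), ?_,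
    fun L _ hL L'' _ b hb => ?_⟩
  · simpa using hδ.add (tendsto_farRate hΛ B)
  obtain ⟨M₀, hM₀⟩ := hDn L hL L'' b hb
  refine ⟨M₀, fun M _ hM => ?_⟩
  obtain ⟨oc, of, ht, hnear, hB⟩ := hM₀ M hM
  have hε : 0 ≤ imagTimeWeight β M := imagTimeWeight_nonneg hβ.le M
  refine ⟨oc, of, ht, ?_⟩
  rw [mul_add]
  refine add_le_add hnear ?_
  exact twoEps_sum_far_le_of_weightedRows hb _ of hε hΛ.le hB

/-- **DOOR (g) — COMMON FRAME `K_L`: NEAR PINNED DEFECT + WEIGHTED ROWS OF BOTH VOLUMES.**  As door (f) with both volumes at the coarse flow frame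
`K_L = klFlowFrameU L M β U μ (n_β+1)`, plus the weighted row profile of the COARSE volume (it pays the one-volume bound of door (d)).
[cite: BenfattoGiulianiMastropietro2006, §2.9 (4.3)-(4.6)] -/
theorem framedNestedFlowTextV17F2_of_commonFramePlainNearDefect_weightedRows
    (hD : ∀ (G : GeoConsts) (P : SplitConsts) (Q : EngConsts) (R : RenConsts), G.WF → P.WF → Q.WF → R.WF →
      ∃ c₅ : ℝ, 0 < c₅ ∧ ∀ c : ℝ, 0 < c → c ≤ c₅ → ∃ U₀ : ℝ, 0 < U₀ ∧
        ∀ μ ∈ klWindowC, ∀ U : ℝ, 0 < U → U ≤ U₀ → ∀ β : ℝ, klBetaMin ≤ β → β ≤ Real.exp (c / U ^ 2) →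
          ∀ K : TrigPolyC4v, klPredsV17F2.frameOK R U (nScales β) μ K →
            ∀ (Lstar : ℕ) (Mstar : ℕ → ℕ), TowerP klPredsV17F2 G P Q R β U μ K Lstar Mstar →
              ∃ L₀ : ℕ, ∃ δ : ℕ → ℝ, ∃ B : ℝ, Tendsto δ atTop (𝓝 0) ∧
                ∀ (L : ℕ) [NeZero L], L₀ ≤ L → ∀ (L'' : ℕ) [NeZero L''] (b : ℕ), L'' = b * L → ∃ M₀ : ℕ, ∀ (M : ℕ) [NeZero M], M₀ ≤ M →
                  ∃ (oc : SpaceTimeIdx L M) (of : SpaceTimeIdx L'' M), of.1 = oc.1 ∧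
                    2 * imagTimeWeight β M *
                      (∑ t₁ : ImagTimeIdx M, ∑ ybar : TorusSite 2 L,
                          ‖sectorisedKernel L M β (trivialMultiplier L M)
                                (klEffectiveAction L M β U μ (klFlowFrameU L M β U μ (nScales β + 1)) klE0 (nScales β + 1)) 2
                                (![((0, 0), 0), ((0, 0), 1)] : Fin 2 → SectorLeg 1) ![oc, (t₁, oc.2 + ybar)] -
                            sectorisedKernel L'' M β (trivialMultiplier L'' M)
                                (klEffectiveAction L'' M β U μ (klFlowFrameU L M β U μ (nScales β + 1)) klE0 (nScales β + 1)) 2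
                                (![((0, 0), 0), ((0, 0), 1)] : Fin 2 → SectorLeg 1) ![of, (t₁, of.2 + Torus.proj L'' (Torus.cRep ybar))]‖) ≤ δ L ∧
                    imagTimeWeight β M *
                      ∑ t₁ : ImagTimeIdx M, ∑ y : TorusSite 2 L'',
                        (1 + klScale klE0 (nScales β + 1) * (Torus.tnorm y : ℝ)) *
                          ‖sectorisedKernel L'' M β (trivialMultiplier L'' M)
                              (klEffectiveAction L'' M β U μ (klFlowFrameU L M β U μ (nScales β + 1)) klE0 (nScales β + 1)) 2
                              (![((0, 0), 0), ((0, 0), 1)] : Fin 2 → SectorLeg 1) ![of, (t₁, of.2 + y)]‖ ≤ B ∧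
                    imagTimeWeight β M *
                      ∑ t₁ : ImagTimeIdx M, ∑ y : TorusSite 2 L,
                        (1 + klScale klE0 (nScales β + 1) * (Torus.tnorm y : ℝ)) *
                          ‖sectorisedKernel L M β (trivialMultiplier L M)
                              (klEffectiveAction L M β U μ (klFlowFrameU L M β U μ (nScales β + 1)) klE0 (nScales β + 1)) 2
                              (![((0, 0), 0), ((0, 0), 1)] : Fin 2 → SectorLeg 1) ![oc, (t₁, oc.2 + y)]‖ ≤ B) :
    ∀ (G : GeoConsts) (P : SplitConsts) (Q : EngConsts) (R : RenConsts), G.WF → P.WF → Q.WF → R.WF →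
      ∃ c₅ : ℝ, 0 < c₅ ∧ ∀ c : ℝ, 0 < c → c ≤ c₅ → ∃ U₀ : ℝ, 0 < U₀ ∧
        ∀ μ ∈ klWindowC, ∀ U : ℝ, 0 < U → U ≤ U₀ → ∀ β : ℝ, klBetaMin ≤ β → β ≤ Real.exp (c / U ^ 2) →
          ∀ K : TrigPolyC4v, klPredsV17F2.frameOK R U (nScales β) μ K →
            ∀ (Lstar : ℕ) (Mstar : ℕ → ℕ), TowerP klPredsV17F2 G P Q R β U μ K Lstar Mstar →
              ∀ n : ℤ, ∃ L₀ : ℕ, ∃ ρ : ℕ → ℝ, Tendsto ρ atTop (𝓝 0) ∧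
                ∀ (L : ℕ) [NeZero L], L₀ ≤ L → ∀ (L'' : ℕ) [NeZero L''], L ∣ L'' → ∃ M₀ : ℕ, ∀ (M : ℕ) [NeZero M], M₀ ≤ M →
                  ∀ (ω : MatsubaraIdx M), matsubaraInt M ω = n → ∀ (k : TorusSite 2 L) (k'' : TorusSite 2 L''),
                    latticeMomentum L'' k'' = latticeMomentum L k →
                      ‖klSelfEnergy L M β U μ (klFlowFrameU L M β U μ (nScales β + 1)) klE0 (nScales β + 1) (ω, k) 0 -
                          klSelfEnergy L'' M β U μ (klFlowFrameU L'' M β U μ (nScales β + 1)) klE0 (nScales β + 1) (ω, k'') 0‖ ≤ ρ L := by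
  refine framedNestedFlowTextV17F2_of_commonFramePlainRowsPinned fun G P Q R hG hP hQ hR => ?_
  obtain ⟨c₅, hc₅, hc⟩ := hD G P Q R hG hP hQ hR
  refine ⟨c₅, hc₅, fun c hc0 hcc => ?_⟩
  obtain ⟨U₀, hU₀, hU⟩ := hc c hc0 hcc
  refine ⟨U₀, hU₀, fun μ hμ U hU0 hUU β hβmin hβmax K hK Lstar Mstar hT => ?_⟩
  have hβ : 0 < β := pos_of_klBetaMin_le hβmin
  have hΛ : 0 < klScale klE0 (nScales β + 1) := klth_klScale_pos _
  obtain ⟨L₀, δ, B, hδ, hDn⟩ := hU μ hμ U hU0 hUU β hβmin hβmax K hK Lstar Mstar hT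
  refine ⟨L₀, fun L => δ L + 2 * B / (1 + klScale klE0 (nScales β + 1) * ((((L - 1) / 2 + 1 : ℕ)) : ℝ)), 2 * B, ?_,
    fun L _ hL L'' _ b hb => ?_⟩
  · simpa using hδ.add (tendsto_farRate hΛ B)
  obtain ⟨M₀, hM₀⟩ := hDn L hL L'' b hb
  refine ⟨M₀, fun M _ hM => ?_⟩
  obtain ⟨oc, of, ht, hnear, hBf, hBc⟩ := hM₀ M hM
  have hε : 0 ≤ imagTimeWeight β M := imagTimeWeight_nonneg hβ.le M
  refine ⟨oc, of, ht, ?_, ?_⟩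
  · rw [mul_add]
    refine add_le_add hnear ?_
    exact twoEps_sum_far_le_of_weightedRows hb _ of hε hΛ.le hBf
  · exact twoEps_sum_le_of_weightedRows _ oc hε hΛ.le hBc

end Summit.HubbardSuperconductivity.HubbardSuperconductivity.Theorems.TwoPointAssembly

end
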